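import Literature.Algebra.EuclideanLattices.LatticeDescentFourier
import HarnessLib

/-!
# Smoothness of periodizations and the Fourier expansion of a periodized bump

Topic `Literature/Algebra/EuclideanLattices`, continuing `LatticePeriodicFunctions`
(`periodize L h = ∑_{ℓ ∈ L} h(· + ℓ)`, `periodize_eq_sum`: a finite sum on every ball) and
`LatticeDescentFourier` (`hasSum_echar`, `mean_echar_mul_periodize`, `norm_mean_echar_mul_le`).

* `contDiff_periodize` — the periodization of a smooth function supported in a ball is smooth
  (locally a finite sum of translates);
* `hasSum_echar_periodize` — **`∑_ℓ h(x + ℓ) = (μ(fdom))⁻¹ ∑_k (∫ h e_{−k}) e_k(x)`**, the Fourier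
  expansion of a periodized smooth bump (Poisson summation in the form needed for the unit torus
  of a number field: Hecke 1920 §1, Mitsui 1956 §3), absolutely convergent.

## References

* E. Hecke, Math. Z. 6 (1920), §1. [cite: HeckeMathZ1920, §1]
* L. Grafakos, *Classical Fourier Analysis* (2014), §3.1–3.3. [cite: Grafakos2014, §3.3.3]
-/

noncomputable section

open MeasureTheory Module Submodule Filter Topology Complex Finset ZSpan
open scoped Real

namespace Literature.Algebra.EuclideanLattices.LatticePeriodic

variable {E : Type*} [NormedAddCommGroup E] [NormedSpace ℝ E] [FiniteDimensional ℝ E]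
variable {L : Submodule ℤ E} [DiscreteTopology L] [IsZLattice ℝ L]

/-- **The periodization of a smooth function supported in a ball is smooth.** [folklore] -/
theorem contDiff_periodize {h : E → ℝ} (hc : ContDiff ℝ (⊤ : ℕ∞) h) {R : ℝ} (hh : ∀ y, R < ‖y‖ → h y = 0) :
    ContDiff ℝ (⊤ : ℕ∞) (periodize L h) := by
  refine contDiff_iff_contDiffAt.2 fun x₀ => ?_
  have hloc : ∀ x ∈ Metric.ball x₀ 1, periodize L h x = ∑ ℓ ∈ ballPts (L := L) (R + (‖x₀‖ + 1)), h (x + ℓ) := by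
    intro x hx
    refine periodize_eq_sum hh ?_
    have := norm_sub_norm_le x x₀
    rw [Metric.mem_ball, dist_eq_norm] at hx
    linarith
  have hsm : ContDiff ℝ (⊤ : ℕ∞) fun x => ∑ ℓ ∈ ballPts (L := L) (R + (‖x₀‖ + 1)), h (x + ℓ) :=
    ContDiff.sum fun ℓ _ => hc.comp (contDiff_id.add contDiff_const)
  refine (hsm.contDiffAt (x := x₀)).congr_of_eventuallyEq ?_
  exact Filter.eventuallyEq_of_mem (Metric.ball_mem_nhds x₀ one_pos) fun x hx => hloc x hx

variable [MeasurableSpace E] [BorelSpace E] (μ : Measure E) [μ.IsAddHaarMeasure]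

/-- **The Fourier expansion of a periodized smooth bump**:
`∑_ℓ h(x + ℓ) = ∑_k (μ(fdom))⁻¹ (∫ h e_{−k}) e_k(x)`, absolutely convergent. [cite: HeckeMathZ1920, §1] -/
theorem hasSum_echar_periodize {h : E → ℝ} (hc : ContDiff ℝ (⊤ : ℕ∞) h) {R : ℝ} (hh : ∀ y, R < ‖y‖ → h y = 0) (x : E) :
    HasSum (fun k : Fin (finrank ℝ E) → ℤ =>
      ((μ.real (fdom L))⁻¹ * ∫ y, (h y : ℂ) * echar L (-k) y ∂μ) * echar L k x) ((periodize L h x : ℝ) : ℂ) := by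
  have hper : ∀ ℓ ∈ L, ∀ y, (fun z => ((periodize L h z : ℝ) : ℂ)) (y + ℓ) = (fun z => ((periodize L h z : ℝ) : ℂ)) y :=
    fun ℓ hℓ y => by simp only; rw [periodize_add_of_mem h hℓ]
  have hsmooth : ContDiff ℝ (⊤ : ℕ∞) fun z => ((periodize L h z : ℝ) : ℂ) :=
    Complex.ofRealCLM.contDiff.comp (contDiff_periodize hc hh)
  have hs := hasSum_echar (L := L) μ hsmooth hper x
  refine hs.congr_fun fun k => ?_ |> fun h' => h'
  rw [mean_echar_mul_periodize μ hc.continuous hh k]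

/-- **Summability of the coefficients of a periodized bump** (uniform majorant form): the series
`∑_k ‖(μ(fdom))⁻¹ ∫ h e_{−k}‖` converges. [cite: Grafakos2014, §3.3.3] -/
theorem summable_norm_coeff_periodize {h : E → ℝ} (hc : ContDiff ℝ (⊤ : ℕ∞) h) {R : ℝ} (hh : ∀ y, R < ‖y‖ → h y = 0) :
    Summable fun k : Fin (finrank ℝ E) → ℤ => ‖(μ.real (fdom L))⁻¹ * ∫ y, (h y : ℂ) * echar L (-k) y ∂μ‖ := by
  have hper : ∀ ℓ ∈ L, ∀ y, (fun z => ((periodize L h z : ℝ) : ℂ)) (y + ℓ) = (fun z => ((periodize L h z : ℝ) : ℂ)) y :=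
    fun ℓ hℓ y => by simp only; rw [periodize_add_of_mem h hℓ]
  have hsmooth : ContDiff ℝ (⊤ : ℕ∞) fun z => ((periodize L h z : ℝ) : ℂ) :=
    Complex.ofRealCLM.contDiff.comp (contDiff_periodize hc hh)
  have hs := summable_norm_mean_echar_mul (L := L) μ hsmooth hper
  refine hs.congr fun k => ?_
  rw [mean_echar_mul_periodize μ hc.continuous hh k]

end Literature.Algebra.EuclideanLattices.LatticePeriodic
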